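import Summits.QuantumFields.BalabanUV.T4Continuum.Support.ActivityStepJunction

/-!
# NE5 ∕ U3, route P2 — the EXPLICIT-CONSTANT face of the activity route: NE5 AT THE INPUT RATE `θ` under the smallness S,
# with `C₅` a displayed expression in the route's letters (skeleton `t4/skeletons/NE5-t4-ne5-p2.md` §6 row A6; BC5 ∕ K-uniformity
# discipline: no `∃ C₅`)

Cell `pub-balaban`, unit `b2b-balaban-t4-ne5-p2-g17` (T⁴ fan-out NE5 ∕ node U3, PROVER seat P2 «polymer-activity Lipschitz route»).
Summits-side new work under the LEAN PLACEMENT RULE (cell bookkeeping over landed leaves; NOT a Literature module).  HONEST FRAMING: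
rung (B)+1 of the FINITE-VOLUME T⁴ continuum programme — NOT infinite volume, NOT a mass gap, NOT the Clay problem, NOT a proof of
NE5 (NOT PRINTED in [Balaban1987RG1]–[Balaban1989LargeFieldII]; they print ε-UNIFORM bounds, never η-RATES).  HONEST DEPENDENCY (cell
line, verbatim): continuum YM on T⁴ ⇐ BetaPertH ∧ nine spine estimates (0/9 proved); BetaPertH ⇐ (D1) ∧ (D4) ∧ CAP+tail; G-an2-4
gates asym, D1 and NE2/3/4.

WHAT THIS FILE DOES.  The term model's END faces (`ActivityTermModel.TermFamily.ne5_at_max_of_model_reach`,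
`ActivityStepJunction.…_step`, `ActivityRouteEnd`, `InsertionLinearRate`, `ClusterRepDecay`) conclude `∃ C₅, NE5 EA EB W κ θ′ C₅`: the
warm-up scale and constant were eliminated existentially (`T4ActivityThreshold.warmup_of_reach`).  For the cell's BC5 ∕ K-UNIFORMITY
discipline a face whose constant is a DISPLAYED EXPRESSION is wanted.  In the regime of the load-bearing smallness
S : `ω + A·Λhist·c∕(s − Λhist·ρ₀′) < θ` (history feedback below the input rate) the lineage's kernel
`T4ActivityRecursion.InputModel.ne5_of_model_actLip₂_scale_nat` gives NE5 AT THE INPUT RATE `θ` ITSELF with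
  `C₅ = ((A·Λhist∕(s − Λhist·ρ₀′))·(δ∕(Λhist∕Λop) + δ′) + B)·(θ − ω) ∕ (θ − (ω + A·Λhist·c∕(s − Λhist·ρ₀′)))`,
where `k₀`, `B` are the warm-up data (`hnear`: from scale `k₀` on the operator displacement plus the accumulated history displacement
stays inside the reach `ρ₀′`; `hfirst`: the first `k₀` scales are paid by the one-run levels, `A₀ + E₀ ≤ B·θ^k`).  This file re-emits
that face for the TERM MODEL (the activity modulus `ActivityLipschitz₂` and `BaseMajorant` DISCHARGED by `activityLipschitz₂_model` ∕
`baseMajorant_model`) and for the term model READING the row owner's step model (`ReadsStep`: walls W1 `N.OperatorRate`, W3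
`N.InsScaleBound`, W4 `N.InsertionRate` in the owner's names): `TermFamily.ne5_of_model_small`, `TermFamily.ne5_of_model_small_step`.
K-UNIFORMITY READ-OFF: every letter of `C₅` (`A, Λop, Λhist, s, ρ₀′, δ, δ′, B, θ, ω, c`) is a constant of the model, none depends
on the number of steps `K` unless an instantiation makes it so (the row's BC5 face: `Support/OutputRateRemainingScale`).
Nothing of the manuscripts under audit is asserted.  0 sorry; no new axioms.
-/

open scoped BigOperators

namespace Summit.QuantumFields.BalabanUV.T4Continuum.ActivityRouteExplicit

open Literature.MathematicalPhysics.QuantumFieldTheory.Balaban1983to89.T4OutputRate (Carriers Functional DecayBound NE5)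
open Literature.MathematicalPhysics.QuantumFieldTheory.Balaban1983to89.T4ActivityLipschitz (ClusterRep)
open Literature.MathematicalPhysics.QuantumFieldTheory.Balaban1983to89.T4ActivityRecursion (InputModel KPInflated)
open Literature.MathematicalPhysics.QuantumFieldTheory.Balaban1983to89.T4InputCauchyRateData (StepModel)
open Summit.QuantumFields.BalabanUV.T4Continuum.ActivityTermModel (TermFamily)
open Summit.QuantumFields.BalabanUV.T4Continuum.ActivityStepJunction (ReadsStep)

variable {C : Carriers} {R : ClusterRep C} {Op Hist : Type*} [NormedAddCommGroup Op] [NormedSpace ℂ Op]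
  [NormedAddCommGroup Hist] [NormedSpace ℂ Hist]
variable {ι κι S Ω Ω₀ 𝒴 𝒞 : Type*} [Fintype ι] [Fintype κι] [MeasurableSpace Ω] [MeasurableSpace Ω₀] {J : Type*}
  [DecidableEq ι] [DecidableEq κι] [DecidableEq 𝒞] (𝔉 : TermFamily R Op Hist ι κι S Ω Ω₀ 𝒴 𝒞 J)

/-- [folklore] The explicit constant of the activity route at the input rate `θ` in the smallness regime S. -/
noncomputable def C5 (A Λop Λhist s ρ₀' δ δ' B θ ω c : ℝ) : ℝ :=
  (A * Λhist / (s - Λhist * ρ₀') * (δ / (Λhist / Λop) + δ') + B) * (θ - ω) /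
    (θ - (ω + A * Λhist / (s - Λhist * ρ₀') * c))

/-- [folklore] **NE5 AT THE INPUT RATE `θ` WITH A DISPLAYED CONSTANT, term model.**  Under the smallness S
`ω + A·Λhist·c∕(s − Λhist·ρ₀′) < θ ≤ 1` and the warm-up data `k₀, B` (`hnear`, `hfirst`):
`NE5 EA EB W κ θ (C5 A Λop Λhist s ρ₀′ δ δ′ B θ ω c)` — `T4ActivityRecursion.InputModel.ne5_of_model_actLip₂_scale_nat` with
`ActivityLipschitz₂` ∕ `BaseMajorant` DISCHARGED for the term model; every other input BY NAME. -/
theorem TermFamily.ne5_of_model_small {EA : Functional C C.BgA} {EB : Functional C C.BgB} {W : Set (ℕ → ℝ)}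
    {m : (ℕ → ℝ) → C.BgB → R.P → ℝ} {a d : R.P → ℝ} {δX : C.Dom → ℝ}
    {A A₀ E₀ E₁ κ θ δ δ' c ω s Λop Λhist ρ₀ ρ₀' B : ℝ} {k₀ : ℕ}
    (hwf : 𝔉.WellFormed W)
    (hsum : ∀ g ∈ W, ∀ (U : C.BgB) (X : C.Dom), ∀ γ ∈ R.vol X, ∑ i ∈ 𝔉.terms g U X γ, 𝔉.G Λop Λhist ρ₀ g U X γ i ≤ m g U γ)
    (hρ01 : ρ₀ ≤ 1)
    (hrep : R.Represents EA EB) (hreal : 𝔉.model.Realizes EA EB W) (hbase : 𝔉.model.InBase EB W)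
    (hKP : KPInflated R W m s a d) (hdec : R.DecayExtract δX d) (hpin : R.PinBudget a δX A κ)
    (hdA : DecayBound EA W A₀ κ) (hdB : DecayBound EB W E₀ κ)
    (hop : 𝔉.model.OperatorRate W δ θ) (hins : 𝔉.model.InsertionRate W κ E₀ δ' θ)
    (haff : 𝔉.model.InsAffine W) (hblind : 𝔉.model.InsBlind W) (hhom : 𝔉.model.InsHomog W)
    (hunit : 𝔉.model.InsScaleBound W κ E₁ c ω)
    (hE₁ : 0 < E₁) (hA : 0 ≤ A) (hΛop : 0 < Λop) (hΛhist : 0 < Λhist) (hρ : max (Λhist / Λop) 1 * ρ₀' ≤ ρ₀)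
    (hs : Λhist * ρ₀' < s) (hδ : 0 ≤ δ) (hδ' : 0 ≤ δ') (hθ : 0 ≤ θ) (hθ1 : θ ≤ 1) (hc : 0 ≤ c) (hω : 0 < ω)
    (hnear : (δ / (Λhist / Λop) + δ') * θ ^ k₀ + c * (A₀ + E₀) / (1 - ω) ≤ ρ₀') (hB : 0 ≤ B)
    (hfirst : ∀ k < k₀, A₀ + E₀ ≤ B * θ ^ k) (hsmall : ω + A * Λhist / (s - Λhist * ρ₀') * c < θ) :
    NE5 EA EB W κ θ (C5 A Λop Λhist s ρ₀' δ δ' B θ ω c) :=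
  𝔉.model.ne5_of_model_actLip₂_scale_nat hrep hreal hbase (𝔉.baseMajorant_model hwf hΛop hΛhist hsum) hKP
    (𝔉.activityLipschitz₂_model hwf hΛop hΛhist hρ01 hsum) hdec hpin hdA hdB hop hins haff hblind hhom hunit hE₁ hA hΛop
    hΛhist hρ hs hδ hδ' hθ hθ1 hc hω hnear hB hfirst hsmall

/-- [folklore] **… for the term model READING the row owner's step model** (walls in P1's names: W1 `N.OperatorRate`, W4
`N.InsertionRate`, W3 `N.InsScaleBound`, structure `N.InsAffine ∕ InsBlind ∕ InsHomog`), same displayed constant. -/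
theorem TermFamily.ne5_of_model_small_step {N : StepModel C Op Hist} (hN : ReadsStep 𝔉.model N)
    {EA : Functional C C.BgA} {EB : Functional C C.BgB} {W : Set (ℕ → ℝ)}
    {m : (ℕ → ℝ) → C.BgB → R.P → ℝ} {a d : R.P → ℝ} {δX : C.Dom → ℝ}
    {A A₀ E₀ E₁ κ θ δ δ' c ω s Λop Λhist ρ₀ ρ₀' B : ℝ} {k₀ : ℕ}
    (hwf : 𝔉.WellFormed W)
    (hsum : ∀ g ∈ W, ∀ (U : C.BgB) (X : C.Dom), ∀ γ ∈ R.vol X, ∑ i ∈ 𝔉.terms g U X γ, 𝔉.G Λop Λhist ρ₀ g U X γ i ≤ m g U γ)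
    (hρ01 : ρ₀ ≤ 1)
    (hrep : R.Represents EA EB) (hreal : 𝔉.model.Realizes EA EB W) (hbase : 𝔉.model.InBase EB W)
    (hKP : KPInflated R W m s a d) (hdec : R.DecayExtract δX d) (hpin : R.PinBudget a δX A κ)
    (hdA : DecayBound EA W A₀ κ) (hdB : DecayBound EB W E₀ κ)
    (hop : N.OperatorRate W δ θ) (hins : N.InsertionRate W κ E₀ δ' θ)
    (haff : N.InsAffine W) (hblind : N.InsBlind W) (hhom : N.InsHomog W) (hunit : N.InsScaleBound W κ E₁ c ω)
    (hE₁ : 0 < E₁) (hA : 0 ≤ A) (hΛop : 0 < Λop) (hΛhist : 0 < Λhist) (hρ : max (Λhist / Λop) 1 * ρ₀' ≤ ρ₀)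
    (hs : Λhist * ρ₀' < s) (hδ : 0 ≤ δ) (hδ' : 0 ≤ δ') (hθ : 0 ≤ θ) (hθ1 : θ ≤ 1) (hc : 0 ≤ c) (hω : 0 < ω)
    (hnear : (δ / (Λhist / Λop) + δ') * θ ^ k₀ + c * (A₀ + E₀) / (1 - ω) ≤ ρ₀') (hB : 0 ≤ B)
    (hfirst : ∀ k < k₀, A₀ + E₀ ≤ B * θ ^ k) (hsmall : ω + A * Λhist / (s - Λhist * ρ₀') * c < θ) :
    NE5 EA EB W κ θ (C5 A Λop Λhist s ρ₀' δ δ' B θ ω c) :=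
  TermFamily.ne5_of_model_small 𝔉 hwf hsum hρ01 hrep hreal hbase hKP hdec hpin hdA hdB (hN.operatorRate hop) (hN.insertionRate hins)
    (hN.insAffine haff) (hN.insBlind hblind) (hN.insHomog hhom) (hN.insScaleBound hunit) hE₁ hA hΛop hΛhist hρ hs hδ hδ' hθ hθ1 hc
    hω hnear hB hfirst hsmall

/-- [folklore] The displayed constant is nonnegative in the regime S (letters ≥ 0, `ω ≤ θ`, feedback below `θ`) — a sanity check
that the face is not vacuous by sign. -/
theorem C5_nonneg {A Λop Λhist s ρ₀' δ δ' B θ ω c : ℝ} (hA : 0 ≤ A) (hΛop : 0 < Λop) (hΛhist : 0 < Λhist)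
    (hs : Λhist * ρ₀' < s) (hδ : 0 ≤ δ) (hδ' : 0 ≤ δ') (hB : 0 ≤ B) (hωθ : ω ≤ θ)
    (hsmall : ω + A * Λhist / (s - Λhist * ρ₀') * c < θ) : 0 ≤ C5 A Λop Λhist s ρ₀' δ δ' B θ ω c := by
  unfold C5
  have hK : 0 ≤ A * Λhist / (s - Λhist * ρ₀') := div_nonneg (mul_nonneg hA hΛhist.le) (sub_pos.2 hs).le
  have h1 : 0 ≤ A * Λhist / (s - Λhist * ρ₀') * (δ / (Λhist / Λop) + δ') + B :=
    add_nonneg (mul_nonneg hK (add_nonneg (div_nonneg hδ (div_pos hΛhist hΛop).le) hδ')) hB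
  exact div_nonneg (mul_nonneg h1 (sub_nonneg.2 hωθ)) (sub_pos.2 hsmall).le

end Summit.QuantumFields.BalabanUV.T4Continuum.ActivityRouteExplicit
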